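import Summits.Ventures.QEDPrecision.SpectralMajorants.BernsteinPremise
import Summits.Ventures.QEDPrecision.BubbleChains.LogPowerIntegrals
import HarnessLib

/-!
# The a-priori end piece `[1 − η, 1]` of the outer quadrature, kernel-checked
(venture QEDPrecision, cell `pub-qed`, literature seat, gen 13; folder `SpectralMajorants/`, file 5)

HONEST FRAMING (verbatim, venture QEDPrecision): independent recomputation; certified where stated,
statistical where stated; no new-physics claim.

## What this file is

§5 of the I(b)/I(c) certificate's premise note `certs/SetIbIc/repr/gl_bounds.md` ("End piece `E_J = [1−η, 1]`,
`η = 2^{−J}`, a priori"): the note's display, VERBATIM in content,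

  "For `y := 1 − x ∈ (0, η]`: `|K(x)| ≤ 𝒦(1−y) ≤ (1/3)ln(1/y)` and `|J₄(x)| ≤ 𝒥(1−y) = Γ·u·atanh(u)`,
   `atanh(u) = ½ln(1/y)` exactly, `u ≤ 1 ⇒ |J₄| ≤ (Γ/2)ln(1/y)`.  Hence
   `|∫_{E_J} F_Q| ≤ c(1/3)^m(Γ/2)^n ∫₀^η y lnᴺ(1/y) dy`, `N = m+n`, and
   `∫₀^η y lnᴺ(1/y) dy = η² Σ_{i=0}^{N} (N!/(N−i)!) ln^{N−i}(1/η)/2^{i+1}`"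

as KERNEL theorems about the typed objects (`Γ = 19`; `F_Q = fQre c m n` of file 4, i.e. `c(1−x)K^m J₄^n` with
`K = ∫₀¹ρ₂/W`, `J₄ = ∫₀¹ρ₄/W` of `Literature/…/Jegerlehner2017/SpectralFunctionInsertions.lean`):

* `kMaj_le_third_log`, `jMaj_eq_half_log`, `jMaj_le_half_log` — the two real majorants near `x = 1`;
* `abs_fQre_le_logpow` — `|F_Q(x)| ≤ c(1−x)(1/3)^m(19/2)^n lnᴺ(1/(1−x))` on `(0,1)`;
* `integral_endPiece_logpow` — `∫_{1−η}^1 (1−x)lnᴺ(1/(1−x)) dx = η²Σ_{i≤N} C(N,i)·i!·ln^{N−i}(1/η)/2^{i+1}`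
  (`C(N,i)·i! = N!/(N−i)!`; substitution `x = 1 − ηv`, binomial theorem, and the tree's
  `BubbleChains.integral_pow_mul_log_pow` `∫₀¹ v lnⁱ v = (−1)ⁱ i!/2^{i+1}`);
* `abs_integral_endPiece_le` — the END-PIECE BOUND `E_Q` with premise and calculus in the kernel, and its four
  specialisations `endPiece_C8/Ib/Ic/C6` (the program `b1p_lib.end_piece_bound` evaluates exactly this formula).

With files 1–4 this leaves, of gl_bounds.md, only §4 (the engine's inner `t`-enclosures of `J₄` at the nodes,
with their two series tails) and the interval arithmetic itself outside the kernel.  No number moves; not an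
R-row.  NEW WORK of the cell (elementary analysis about the cell's typed objects), not a published result;
nothing here is cited as a fact anywhere; no numerical value of any anomaly integral is asserted.
-/

noncomputable section

open Real Set MeasureTheory intervalIntegral Finset

namespace Summit.Ventures.QEDPrecision.SpectralMajorants

open Literature.MathematicalPhysics.QuantumFieldTheory.Jegerlehner2017

/-! ### The two real majorants near `x = 1` -/

/-- `𝒦(x) ≤ (1/3)·ln(1/(1−x))` for `0 ≤ x < 1`. -/
theorem kMaj_le_third_log {x : ℝ} (hx0 : 0 ≤ x) :
    kMaj x ≤ 1 / 3 * log (1 / (1 - x)) := by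
  unfold kMaj
  rw [one_div (1 - x), Real.log_inv]
  linarith

/-- `𝒥(x) = 19·u·½ln(1/(1−x))` exactly, `u = x/(2−x)` ("`atanh(u) = ½ln(1/y)` exactly"). -/
theorem jMaj_eq_half_log {x : ℝ} (hx1 : x < 1) :
    jMaj x = 19 * (x / (2 - x)) * (log (1 / (1 - x)) / 2) := by
  unfold jMaj
  have h2x : (0:ℝ) < 2 - x := by linarith
  have h1 : 1 + x / (2 - x) = 2 / (2 - x) := by field_simp; ring
  have h2 : 1 - x / (2 - x) = 2 * (1 - x) / (2 - x) := by field_simp; ring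
  have h1x : (0:ℝ) < 1 - x := by linarith
  have h3 : (2 / (2 - x)) / (2 * (1 - x) / (2 - x)) = 1 / (1 - x) := by
    field_simp
  rw [h1, h2, ← Real.log_div (by positivity) (by positivity), h3]

/-- `𝒥(x) ≤ (19/2)·ln(1/(1−x))` for `0 ≤ x < 1` (`u ≤ 1`). -/
theorem jMaj_le_half_log {x : ℝ} (hx0 : 0 ≤ x) (hx1 : x < 1) :
    jMaj x ≤ 19 / 2 * log (1 / (1 - x)) := by
  rw [jMaj_eq_half_log hx1]
  have h2x : (0:ℝ) < 2 - x := by linarith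
  have hu0 : 0 ≤ x / (2 - x) := div_nonneg hx0 h2x.le
  have hu1 : x / (2 - x) ≤ 1 := by rw [div_le_one h2x]; linarith
  have hL : 0 ≤ log (1 / (1 - x)) := by
    apply Real.log_nonneg
    rw [le_div_iff₀ (by linarith)]; linarith
  nlinarith

/-- **§5 pointwise**: `|F_Q(x)| ≤ c(1−x)(1/3)^m(19/2)^n·lnᴺ(1/(1−x))` on `(0,1)`, `N = m+n`. -/
theorem abs_fQre_le_logpow {cQ : ℝ} (hc : 0 ≤ cQ) (m n : ℕ) {x : ℝ} (hx0 : 0 < x) (hx1 : x < 1) :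
    |fQre cQ m n x| ≤
      cQ * (1 - x) * (1 / 3) ^ m * (19 / 2) ^ n * log (1 / (1 - x)) ^ (m + n) := by
  have hK := (abs_integral_rho2_div_wt_le_kMaj hx0 hx1).trans (kMaj_le_third_log hx0.le)
  have hJ := (abs_integral_rho4_div_wt_le_jMaj hx0 hx1).trans (jMaj_le_half_log hx0.le hx1)
  have hL : 0 ≤ log (1 / (1 - x)) := by
    apply Real.log_nonneg
    rw [le_div_iff₀ (by linarith)]; linarith
  unfold fQre
  rw [abs_mul, abs_mul, abs_mul, abs_of_nonneg hc, abs_of_nonneg (by linarith : (0:ℝ) ≤ 1 - x), abs_pow,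
    abs_pow]
  have hKm : |∫ t in (0:ℝ)..1, rho2 t / wt t x 1| ^ m ≤ (1 / 3 * log (1 / (1 - x))) ^ m :=
    pow_le_pow_left₀ (abs_nonneg _) hK m
  have hJn : |∫ t in (0:ℝ)..1, rho4 t / wt t x 1| ^ n ≤ (19 / 2 * log (1 / (1 - x))) ^ n :=
    pow_le_pow_left₀ (abs_nonneg _) hJ n
  calc cQ * (1 - x) * |∫ t in (0:ℝ)..1, rho2 t / wt t x 1| ^ m * |∫ t in (0:ℝ)..1, rho4 t / wt t x 1| ^ n
      ≤ cQ * (1 - x) * (1 / 3 * log (1 / (1 - x))) ^ m * (19 / 2 * log (1 / (1 - x))) ^ n := by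
        gcongr
    _ = cQ * (1 - x) * (1 / 3) ^ m * (19 / 2) ^ n * log (1 / (1 - x)) ^ (m + n) := by
        rw [mul_pow, mul_pow, pow_add]; ring

/-! ### The calculus: `∫₀^η y lnᴺ(1/y) dy` in closed form -/

/-- `∫₀¹ v·lnⁱ(1/v) dv = i!/2^{i+1}` (from the tree's `∫₀¹ v lnⁱ v = (−1)ⁱ i!/2^{i+1}`). -/
theorem integral_id_mul_log_inv_pow (i : ℕ) :
    ∫ v in (0:ℝ)..1, v * log (1 / v) ^ i = (i.factorial : ℝ) / 2 ^ (i + 1) := by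
  have h := Summit.Ventures.QEDPrecision.BubbleChains.integral_pow_mul_log_pow 1 i
  have e : (fun v : ℝ => v * log (1 / v) ^ i) = fun v : ℝ => (-1) ^ i * (v ^ 1 * log v ^ i) := by
    funext v
    rw [one_div, Real.log_inv, pow_one, neg_pow]
    ring
  rw [Nat.cast_one, one_add_one_eq_two] at h
  rw [e, intervalIntegral.integral_const_mul, h]
  have h3 : ((-1:ℝ) ^ i * (-1) ^ i) = 1 := by rw [← mul_pow]; norm_num
  calc (-1:ℝ) ^ i * ((-1) ^ i * (i.factorial : ℝ) / 2 ^ (i + 1))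
      = ((-1:ℝ) ^ i * (-1) ^ i) * (i.factorial : ℝ) / 2 ^ (i + 1) := by ring
    _ = (i.factorial : ℝ) / 2 ^ (i + 1) := by rw [h3, one_mul]

/-- `v·lnⁱ(1/v)` is interval-integrable on `[0,1]`. -/
theorem intervalIntegrable_id_mul_log_inv_pow (i : ℕ) :
    IntervalIntegrable (fun v : ℝ => v * log (1 / v) ^ i) volume 0 1 := by
  have h := (Summit.Ventures.QEDPrecision.BubbleChains.intervalIntegrable_pow_mul_log_pow 1 i).const_mul
    ((-1 : ℝ) ^ i)
  refine h.congr ?_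
  intro v _
  simp only
  rw [one_div, Real.log_inv, pow_one, neg_pow]
  ring

/-- **§5 calculus**: `∫_{1−η}^{1} (1−x)·lnᴺ(1/(1−x)) dx = η²·Σ_{i=0}^{N} C(N,i)·i!·ln^{N−i}(1/η)/2^{i+1}`
(`= η² Σ (N!/(N−i)!) ln^{N−i}(1/η)/2^{i+1}`), for `0 < η`. -/
theorem integral_endPiece_logpow (N : ℕ) {η : ℝ} (hη0 : 0 < η) :
    ∫ x in (1 - η)..1, (1 - x) * log (1 / (1 - x)) ^ N =
      η ^ 2 * ∑ i ∈ range (N + 1),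
        (N.choose i : ℝ) * (i.factorial : ℝ) * log (1 / η) ^ (N - i) / 2 ^ (i + 1) := by
  -- x ↦ 1 − y
  have h1 : ∫ x in (1 - η)..1, (1 - x) * log (1 / (1 - x)) ^ N
      = ∫ y in (0:ℝ)..η, y * log (1 / y) ^ N := by
    have h := intervalIntegral.integral_comp_sub_left (fun y : ℝ => y * log (1 / y) ^ N)
      (a := 1 - η) (b := 1) 1
    simp only [sub_self, sub_sub_cancel] at h
    exact h
  -- y ↦ η v
  have h2 : ∫ y in (0:ℝ)..η, y * log (1 / y) ^ N
      = η * ∫ v in (0:ℝ)..1, (η * v) * log (1 / (η * v)) ^ N := by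
    have h := intervalIntegral.mul_integral_comp_mul_left (f := fun y : ℝ => y * log (1 / y) ^ N)
      (a := 0) (b := 1) η
    simp only [mul_zero, mul_one] at h
    exact h.symm
  -- expand the integrand on [0,1]
  have h3 : ∫ v in (0:ℝ)..1, (η * v) * log (1 / (η * v)) ^ N
      = ∫ v in (0:ℝ)..1, η * ∑ i ∈ range (N + 1),
          ((N.choose i : ℝ) * log (1 / η) ^ (N - i)) * (v * log (1 / v) ^ i) := by
    refine intervalIntegral.integral_congr ?_
    intro v hv
    rw [Set.uIcc_of_le zero_le_one] at hv
    simp only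
    rcases eq_or_lt_of_le hv.1 with h | hvpos
    · subst h; simp
    · have hlog : log (1 / (η * v)) = log (1 / v) + log (1 / η) := by
        rw [one_div, one_div, one_div, mul_inv, Real.log_mul (inv_ne_zero hη0.ne') (inv_ne_zero hvpos.ne')]
        ring
      rw [hlog, add_pow, mul_sum, mul_sum]
      refine Finset.sum_congr rfl fun i _ => ?_
      ring
  have h4 : ∫ v in (0:ℝ)..1, η * ∑ i ∈ range (N + 1),
        ((N.choose i : ℝ) * log (1 / η) ^ (N - i)) * (v * log (1 / v) ^ i)
      = η * ∑ i ∈ range (N + 1),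
          (N.choose i : ℝ) * log (1 / η) ^ (N - i) * ((i.factorial : ℝ) / 2 ^ (i + 1)) := by
    rw [intervalIntegral.integral_const_mul, intervalIntegral.integral_finsetSum]
    · congr 1
      refine Finset.sum_congr rfl fun i _ => ?_
      rw [intervalIntegral.integral_const_mul, integral_id_mul_log_inv_pow]
    · intro i _
      exact (intervalIntegrable_id_mul_log_inv_pow i).const_mul _
  rw [h1, h2, h3, h4, ← mul_assoc, ← pow_two, mul_sum, mul_sum]
  refine Finset.sum_congr rfl fun i _ => ?_
  ring

/-- The bound integrand `(1−x)lnᴺ(1/(1−x))` is interval-integrable on `[1−η, 1]` (`0 < η ≤ 1`). -/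
theorem intervalIntegrable_endPiece_logpow (N : ℕ) {η : ℝ} (hη0 : 0 < η) (hη1 : η ≤ 1) :
    IntervalIntegrable (fun x : ℝ => (1 - x) * log (1 / (1 - x)) ^ N) volume (1 - η) 1 := by
  have h := (intervalIntegrable_id_mul_log_inv_pow N).comp_sub_left 1
  simp only [sub_zero, sub_self] at h
  -- h : IntervalIntegrable (fun x => (1 - x) * log (1 / (1 - x)) ^ N) volume 1 0
  refine (h.symm.mono_set ?_)
  rw [Set.uIcc_of_le zero_le_one, Set.uIcc_of_le (by linarith)]
  exact Icc_subset_Icc (by linarith) le_rfl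

/-! ### The end-piece bound -/

/-- **§5, the end-piece bound `E_Q`**: for `0 ≤ c_Q`, `0 < η ≤ 1`,
`|∫_{1−η}^{1} F_Q| ≤ c_Q (1/3)^m (19/2)^n · η² Σ_{i≤N} C(N,i) i! ln^{N−i}(1/η)/2^{i+1}`, `N = m + n`. -/
theorem abs_integral_endPiece_le {cQ : ℝ} (hc : 0 ≤ cQ) (m n : ℕ) {η : ℝ} (hη0 : 0 < η) (hη1 : η ≤ 1) :
    |∫ x in (1 - η)..1, fQre cQ m n x| ≤
      cQ * (1 / 3) ^ m * (19 / 2) ^ n * (η ^ 2 * ∑ i ∈ range (m + n + 1),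
        ((m + n).choose i : ℝ) * (i.factorial : ℝ) * log (1 / η) ^ (m + n - i) / 2 ^ (i + 1)) := by
  have hle : (1:ℝ) - η ≤ 1 := by linarith
  have hb : ∀ᵐ x : ℝ, x ∈ Ioc (1 - η) 1 → ‖fQre cQ m n x‖ ≤
      cQ * (1 / 3) ^ m * (19 / 2) ^ n * ((1 - x) * log (1 / (1 - x)) ^ (m + n)) := by
    refine Filter.Eventually.of_forall fun x hx => ?_
    rw [Real.norm_eq_abs]
    rcases eq_or_lt_of_le hx.2 with h | h
    · subst h
      simp [fQre]
    · have h0 : 0 < x := by linarith [hx.1]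
      have := abs_fQre_le_logpow hc m n h0 h
      calc |fQre cQ m n x| ≤ cQ * (1 - x) * (1 / 3) ^ m * (19 / 2) ^ n * log (1 / (1 - x)) ^ (m + n) := this
        _ = cQ * (1 / 3) ^ m * (19 / 2) ^ n * ((1 - x) * log (1 / (1 - x)) ^ (m + n)) := by ring
  have hI := ((intervalIntegrable_endPiece_logpow (m + n) hη0 hη1).const_mul
    (cQ * (1 / 3) ^ m * (19 / 2) ^ n))
  have h := intervalIntegral.norm_integral_le_of_norm_le hle hb hI
  rw [Real.norm_eq_abs] at h
  refine h.trans (le_of_eq ?_)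
  rw [intervalIntegral.integral_const_mul, integral_endPiece_logpow (m + n) hη0]

/-- `E_{I(c)}`: `|∫_{1−η}^1 (1−x)J₄(x)² dx| ≤ (19/2)²·η²Σ_{i≤2} C(2,i)i! ln^{2−i}(1/η)/2^{i+1}`. -/
theorem endPiece_Ic {η : ℝ} (hη0 : 0 < η) (hη1 : η ≤ 1) :
    |∫ x in (1 - η)..1, (1 - x) * (∫ t in (0:ℝ)..1, rho4 t / wt t x 1) ^ 2| ≤
      (19 / 2) ^ 2 * (η ^ 2 * ∑ i ∈ range 3,
        ((2:ℕ).choose i : ℝ) * (i.factorial : ℝ) * log (1 / η) ^ (2 - i) / 2 ^ (i + 1)) := by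
  have H := abs_integral_endPiece_le (cQ := 1) zero_le_one 0 2 hη0 hη1
  simp only [fQre_Ic, pow_zero, one_mul, mul_one, Nat.zero_add] at H
  exact H

/-- `E_{I(b)}`: `|∫_{1−η}^1 3(1−x)K²J₄ dx| ≤ 3(1/3)²(19/2)·η²Σ_{i≤3} C(3,i)i! ln^{3−i}(1/η)/2^{i+1}`. -/
theorem endPiece_Ib {η : ℝ} (hη0 : 0 < η) (hη1 : η ≤ 1) :
    |∫ x in (1 - η)..1, 3 * (1 - x) * (∫ t in (0:ℝ)..1, rho2 t / wt t x 1) ^ 2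
        * (∫ t in (0:ℝ)..1, rho4 t / wt t x 1)| ≤
      3 * (1 / 3) ^ 2 * (19 / 2) ^ 1 * (η ^ 2 * ∑ i ∈ range 4,
        ((3:ℕ).choose i : ℝ) * (i.factorial : ℝ) * log (1 / η) ^ (3 - i) / 2 ^ (i + 1)) := by
  have H := abs_integral_endPiece_le (cQ := 3) (by norm_num) 2 1 hη0 hη1
  simp only [fQre_Ib] at H
  exact H

/-- `E_{C₈}`: `|∫_{1−η}^1 2(1−x)K J₄ dx| ≤ 2(1/3)(19/2)·η²Σ_{i≤2} C(2,i)i! ln^{2−i}(1/η)/2^{i+1}`. -/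
theorem endPiece_C8 {η : ℝ} (hη0 : 0 < η) (hη1 : η ≤ 1) :
    |∫ x in (1 - η)..1, 2 * (1 - x) * (∫ t in (0:ℝ)..1, rho2 t / wt t x 1)
        * (∫ t in (0:ℝ)..1, rho4 t / wt t x 1)| ≤
      2 * (1 / 3) ^ 1 * (19 / 2) ^ 1 * (η ^ 2 * ∑ i ∈ range 3,
        ((2:ℕ).choose i : ℝ) * (i.factorial : ℝ) * log (1 / η) ^ (2 - i) / 2 ^ (i + 1)) := by
  have H := abs_integral_endPiece_le (cQ := 2) (by norm_num) 1 1 hη0 hη1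
  simp only [fQre_C8] at H
  exact H

/-- `E_{C₆}`: `|∫_{1−η}^1 (1−x)J₄ dx| ≤ (19/2)·η²Σ_{i≤1} C(1,i)i! ln^{1−i}(1/η)/2^{i+1}`. -/
theorem endPiece_C6 {η : ℝ} (hη0 : 0 < η) (hη1 : η ≤ 1) :
    |∫ x in (1 - η)..1, (1 - x) * (∫ t in (0:ℝ)..1, rho4 t / wt t x 1)| ≤
      (19 / 2) ^ 1 * (η ^ 2 * ∑ i ∈ range 2,
        ((1:ℕ).choose i : ℝ) * (i.factorial : ℝ) * log (1 / η) ^ (1 - i) / 2 ^ (i + 1)) := by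
  have H := abs_integral_endPiece_le (cQ := 1) zero_le_one 0 1 hη0 hη1
  simp only [fQre_C6, pow_zero, one_mul, Nat.zero_add] at H
  exact H

end Summit.Ventures.QEDPrecision.SpectralMajorants

end
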